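/-
Fleet lead `ym-wcr-19609-p1` (seat prover-ym-wcr-19609-p1-g2-0), route `WeakCouplingRates`, crux `BulkDominatesColdBoxW`
(stmt-QuantumFields-19609), line `dlr-chessboard` (v6): the deterministic CORE of the A-cov assembly (`stub_kernelCovExpansion`), abstract trunk hypotheses.
-/
import Summits.QuantumFields.YangMills.Theorems.WeakCouplingRatesBulkDominatesColdBoxWKernelGoodEvent
import Summits.QuantumFields.YangMills.Theorems.WeakCouplingRatesColdBoxCovBookkeeping
import Summits.QuantumFields.YangMills.Theorems.WeakCouplingRatesColdBoxDirichletShiftedCov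
import Summits.QuantumFields.YangMills.Theorems.WeakCouplingRatesColdBoxDirichletShiftedMean

/-!
# Crux `BulkDominatesColdBoxW`, stub `stub_kernelCovExpansion`: the A-cov CORE — kernel two-point function = Gaussian value up to the five
# bookkeeping errors, with the trunk (representation, tilt, surrogate) as ABSTRACT hypotheses

The covariance twin of `abs_kernelMean_sub_gaussian_le_core` (seat ym-spine-20043-p1, `…KernelMeanCore`), i.e. steps (c)–(h) of the critic's
STUB-PLAN rev 2 §2 A-cov with (d) = the representation as a HYPOTHESIS for the three observables `βc_x`, `βc_y`, `βc_x·βc_y` under the same good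
event `G`, chart map `cfg`, Gaussian good event `S` and tilt `W`:

  `|β²·Cov_{γ(·|ω)}(c_x, c_y) − ((3/2)·C² + (Σ_c F_c G_c)·C)| ≤ 6M²·pY + 3M²(e^{2w} − 1) + 6M²p + 2τ(M + K) + √p(2MK + K' + K²)`,

`C = boxDirProjKernel H p' q'`, where `Q₁ = ½Σ_c(F_c + X_c(p'))²`, `Q₂ = ½Σ_c(G_c + X_c(q'))²` are the quadratic surrogates (`|βc∘cfg − Q| ≤ τ` on `S`),
`M` bounds `βc` (globally in absolute value and on `S` from above), `pY ≥ γ(·|ω)(Gᶜ)`, `p ≥ D^{⊗3}(Sᶜ)`, `|𝟙_S W| ≤ w`, `∫Q_i² ≤ K²`, `∫(Q₁Q₂)² ≤ K'²`.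
Ingredients: YM conditioning `abs_cov_sub_cov_cond_le`; R6 `abs_cov_tilted_cond_sub_cov_le` (seat ym-wcr-19456-p1); the exact Gaussian covariance
`cov_quadObs_pi_eq` (seat ym-spine-20043-p1).  The assembler instantiates `G = coldGoodSet`, `cfg = cfgTD`, `S = goodTD`, `W = tiltWD` (T3/T4 of the
ϑ-pass), `F, G =` scaled background circulations, after the transport `ω ↦ W` (`…KernelBridge`).  No new definition; standard axioms.
NOT a claim about the mass gap.
-/

set_option autoImplicit false

noncomputable section

open MeasureTheory ProbabilityTheory Finset
open Literature.Probability.LatticeModels Literature.MathematicalPhysics.QuantumLattice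
open Literature.MathematicalPhysics.QuantumFieldTheory

namespace Summit.QuantumFields.YangMills.Theorems.WeakCouplingRates

/-- **A-cov core.**  See the module docstring. -/
theorem abs_kernelCov_sub_gaussian_le_core {H : ℕ} {β : ℝ} (ω : LGConfig 4 (Matrix.specialUnitaryGroup (Fin 2) ℂ))
    (x y : Site 4) (i j k l : Fin 4)
    -- YM side: the good event of configurations
    {G : Set (LGConfig 4 (Matrix.specialUnitaryGroup (Fin 2) ℂ))} (hG : MeasurableSet G) (hG0 : boxKernel β H ω G ≠ 0)
    {pY : ℝ} (hpY : (boxKernel β H ω).real Gᶜ ≤ pY)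
    {M : ℝ} (hM : 0 ≤ M) (hfM : ∀ U, |β * plaqCostAt (fundamentalRep (Fin 2)) x i j U| ≤ M)
    (hgM : ∀ U, |β * plaqCostAt (fundamentalRep (Fin 2)) y k l U| ≤ M)
    -- Gaussian side: chart map, small-field event, tilt
    (cfg : (Fin 3 → EuclideanSpace ℝ (DirFree H)) → LGConfig 4 (Matrix.specialUnitaryGroup (Fin 2) ℂ)) (hcfg : Measurable cfg)
    {S : Set (Fin 3 → EuclideanSpace ℝ (DirFree H))} (hS : MeasurableSet S) (hS0 : (Measure.pi fun _ : Fin 3 => boxDirichlet H) S ≠ 0)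
    {p : ℝ} (hp : (Measure.pi fun _ : Fin 3 => boxDirichlet H).real Sᶜ ≤ p)
    {W : (Fin 3 → EuclideanSpace ℝ (DirFree H)) → ℝ} (hWm : Measurable W) {w : ℝ} (hW : ∀ t, |S.indicator W t| ≤ w)
    -- the representation (trunk) for the three observables
    (hRepF : ∫ U, β * plaqCostAt (fundamentalRep (Fin 2)) x i j U ∂((boxKernel β H ω)[|G]) =
      ∫ t, β * plaqCostAt (fundamentalRep (Fin 2)) x i j (cfg t)
        ∂(((Measure.pi fun _ : Fin 3 => boxDirichlet H)[|S]).tilted (S.indicator W)))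
    (hRepG : ∫ U, β * plaqCostAt (fundamentalRep (Fin 2)) y k l U ∂((boxKernel β H ω)[|G]) =
      ∫ t, β * plaqCostAt (fundamentalRep (Fin 2)) y k l (cfg t)
        ∂(((Measure.pi fun _ : Fin 3 => boxDirichlet H)[|S]).tilted (S.indicator W)))
    (hRepFG : ∫ U, β * plaqCostAt (fundamentalRep (Fin 2)) x i j U * (β * plaqCostAt (fundamentalRep (Fin 2)) y k l U)
        ∂((boxKernel β H ω)[|G]) =
      ∫ t, β * plaqCostAt (fundamentalRep (Fin 2)) x i j (cfg t) * (β * plaqCostAt (fundamentalRep (Fin 2)) y k l (cfg t))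
        ∂(((Measure.pi fun _ : Fin 3 => boxDirichlet H)[|S]).tilted (S.indicator W)))
    -- the surrogates (chart) on `S` and their moments
    (F G' : Fin 3 → ℝ) (p' q' : Plaq 4) {τ K K' : ℝ} (hτ : 0 ≤ τ) (hK : 0 ≤ K) (hK' : 0 ≤ K')
    (hFS : ∀ t ∈ S, 0 ≤ β * plaqCostAt (fundamentalRep (Fin 2)) x i j (cfg t) ∧ β * plaqCostAt (fundamentalRep (Fin 2)) x i j (cfg t) ≤ M)
    (hGS : ∀ t ∈ S, 0 ≤ β * plaqCostAt (fundamentalRep (Fin 2)) y k l (cfg t) ∧ β * plaqCostAt (fundamentalRep (Fin 2)) y k l (cfg t) ≤ M)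
    (hSurF : ∀ t ∈ S, |β * plaqCostAt (fundamentalRep (Fin 2)) x i j (cfg t) - (1 / 2 : ℝ) * ∑ c, (F c + dirCirc H p' (t c)) ^ 2| ≤ τ)
    (hSurG : ∀ t ∈ S, |β * plaqCostAt (fundamentalRep (Fin 2)) y k l (cfg t) - (1 / 2 : ℝ) * ∑ c, (G' c + dirCirc H q' (t c)) ^ 2| ≤ τ)
    (hQ₁₂ : MemLp (fun t : Fin 3 → EuclideanSpace ℝ (DirFree H) =>
      ((1 / 2 : ℝ) * ∑ c, (F c + dirCirc H p' (t c)) ^ 2) * ((1 / 2 : ℝ) * ∑ c, (G' c + dirCirc H q' (t c)) ^ 2)) 2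
      (Measure.pi fun _ : Fin 3 => boxDirichlet H))
    (hK₁ : ∫ t, ((1 / 2 : ℝ) * ∑ c, (F c + dirCirc H p' (t c)) ^ 2) ^ 2 ∂(Measure.pi fun _ : Fin 3 => boxDirichlet H) ≤ K ^ 2)
    (hK₂ : ∫ t, ((1 / 2 : ℝ) * ∑ c, (G' c + dirCirc H q' (t c)) ^ 2) ^ 2 ∂(Measure.pi fun _ : Fin 3 => boxDirichlet H) ≤ K ^ 2)
    (hK₁₂ : ∫ t, (((1 / 2 : ℝ) * ∑ c, (F c + dirCirc H p' (t c)) ^ 2) * ((1 / 2 : ℝ) * ∑ c, (G' c + dirCirc H q' (t c)) ^ 2)) ^ 2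
      ∂(Measure.pi fun _ : Fin 3 => boxDirichlet H) ≤ K' ^ 2) :
    |β ^ 2 * ((∫ U, plaqCostAt (fundamentalRep (Fin 2)) x i j U * plaqCostAt (fundamentalRep (Fin 2)) y k l U ∂(boxKernel β H ω)) -
          (∫ U, plaqCostAt (fundamentalRep (Fin 2)) x i j U ∂(boxKernel β H ω)) *
            (∫ U, plaqCostAt (fundamentalRep (Fin 2)) y k l U ∂(boxKernel β H ω))) -
        (3 / 2 * boxDirProjKernel H p' q' ^ 2 + (∑ c, F c * G' c) * boxDirProjKernel H p' q')| ≤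
      6 * M * M * pY + (3 * M ^ 2 * (Real.exp (2 * w) - 1) + 6 * M ^ 2 * p + 2 * τ * (M + K) +
        Real.sqrt p * (2 * M * K + K' + K ^ 2)) := by
  haveI : IsProbabilityMeasure (boxKernel β H ω) := isProbabilityMeasure_boxKernel β H ω
  set μ := boxKernel β H ω with hμ
  set γ : Measure (Fin 3 → EuclideanSpace ℝ (DirFree H)) := Measure.pi fun _ : Fin 3 => boxDirichlet H with hγ
  set f : LGConfig 4 (Matrix.specialUnitaryGroup (Fin 2) ℂ) → ℝ := fun U => β * plaqCostAt (fundamentalRep (Fin 2)) x i j U with hf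
  set g : LGConfig 4 (Matrix.specialUnitaryGroup (Fin 2) ℂ) → ℝ := fun U => β * plaqCostAt (fundamentalRep (Fin 2)) y k l U with hg
  set Q₁ : (Fin 3 → EuclideanSpace ℝ (DirFree H)) → ℝ := fun t => (1 / 2 : ℝ) * ∑ c, (F c + dirCirc H p' (t c)) ^ 2 with hQ₁
  set Q₂ : (Fin 3 → EuclideanSpace ℝ (DirFree H)) → ℝ := fun t => (1 / 2 : ℝ) * ∑ c, (G' c + dirCirc H q' (t c)) ^ 2 with hQ₂
  have hfm : Measurable f := measurable_const.mul (measurable_plaqCostAt x i j)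
  have hgm : Measurable g := measurable_const.mul (measurable_plaqCostAt y k l)
  have hfi : Integrable f μ := integrable_of_abs_le hfm.aestronglyMeasurable hfM
  have hgi : Integrable g μ := integrable_of_abs_le hgm.aestronglyMeasurable hgM
  have hfgi : Integrable (fun U => f U * g U) μ :=
    hgi.bdd_mul hfm.aestronglyMeasurable (ae_of_all _ fun U => by rw [Real.norm_eq_abs]; exact hfM U)
  -- (0) `β²·Cov(c_x, c_y) = Cov(βc_x, βc_y)`
  have e0 : β ^ 2 * ((∫ U, plaqCostAt (fundamentalRep (Fin 2)) x i j U * plaqCostAt (fundamentalRep (Fin 2)) y k l U ∂μ) -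
        (∫ U, plaqCostAt (fundamentalRep (Fin 2)) x i j U ∂μ) * (∫ U, plaqCostAt (fundamentalRep (Fin 2)) y k l U ∂μ)) =
      (∫ U, f U * g U ∂μ) - (∫ U, f U ∂μ) * (∫ U, g U ∂μ) := by
    have e1 : ∫ U, f U * g U ∂μ = β ^ 2 * ∫ U, plaqCostAt (fundamentalRep (Fin 2)) x i j U * plaqCostAt (fundamentalRep (Fin 2)) y k l U ∂μ := by
      rw [← integral_const_mul]; refine integral_congr_ae (ae_of_all _ fun U => ?_); simp only [hf, hg]; ring
    rw [e1, hf, hg, integral_const_mul, integral_const_mul]; ring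
  -- (1) YM conditioning
  have h1 : |((∫ U, f U * g U ∂μ) - (∫ U, f U ∂μ) * (∫ U, g U ∂μ)) -
      ((∫ U, f U * g U ∂(μ[|G])) - (∫ U, f U ∂(μ[|G])) * (∫ U, g U ∂(μ[|G])))| ≤ 6 * M * M * pY := by
    have key := abs_cov_sub_cov_cond_le (μ := μ) hG hG0 hfi hgi hfgi hfM hgM
    have h6 : 0 ≤ 6 * M * M := by positivity
    exact key.trans (mul_le_mul_of_nonneg_left hpY h6)
  -- (2)+(3) representation and covariance bookkeeping on the Gaussian side
  have hQ₁m : MemLp Q₁ 2 γ := memLp_two_quadObs_pi F p'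
  have hQ₂m : MemLp Q₂ 2 γ := memLp_two_quadObs_pi G' q'
  have hFm : Measurable fun t => f (cfg t) := hfm.comp hcfg
  have hGm : Measurable fun t => g (cfg t) := hgm.comp hcfg
  have h3 := abs_cov_tilted_cond_sub_cov_le (γ := γ) hS hS0 hWm hW (F := fun t => f (cfg t)) (G := fun t => g (cfg t))
    (Q₁ := Q₁) (Q₂ := Q₂) hFm hGm hQ₁m hQ₂m hQ₁₂ hM hτ hK hK' hFS hGS hSurF hSurG hp hK₁ hK₂ hK₁₂
  -- (4) the exact Gaussian covariance
  have h4 : (∫ t, Q₁ t * Q₂ t ∂γ) - (∫ t, Q₁ t ∂γ) * (∫ t, Q₂ t ∂γ) =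
      3 / 2 * boxDirProjKernel H p' q' ^ 2 + (∑ c, F c * G' c) * boxDirProjKernel H p' q' := cov_quadObs_pi_eq F G' p' q'
  -- assemble
  rw [e0, ← h4]
  have hrepF' : ∫ U, f U ∂(μ[|G]) = ∫ t, f (cfg t) ∂((γ[|S]).tilted (S.indicator W)) := hRepF
  have hrepG' : ∫ U, g U ∂(μ[|G]) = ∫ t, g (cfg t) ∂((γ[|S]).tilted (S.indicator W)) := hRepG
  have hrepFG' : ∫ U, f U * g U ∂(μ[|G]) = ∫ t, f (cfg t) * g (cfg t) ∂((γ[|S]).tilted (S.indicator W)) := hRepFG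
  rw [hrepF', hrepG', hrepFG'] at h1
  calc |((∫ U, f U * g U ∂μ) - (∫ U, f U ∂μ) * (∫ U, g U ∂μ)) - ((∫ t, Q₁ t * Q₂ t ∂γ) - (∫ t, Q₁ t ∂γ) * (∫ t, Q₂ t ∂γ))|
      ≤ |((∫ U, f U * g U ∂μ) - (∫ U, f U ∂μ) * (∫ U, g U ∂μ)) -
            ((∫ t, f (cfg t) * g (cfg t) ∂((γ[|S]).tilted (S.indicator W))) -
              (∫ t, f (cfg t) ∂((γ[|S]).tilted (S.indicator W))) * (∫ t, g (cfg t) ∂((γ[|S]).tilted (S.indicator W))))| +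
          |((∫ t, f (cfg t) * g (cfg t) ∂((γ[|S]).tilted (S.indicator W))) -
              (∫ t, f (cfg t) ∂((γ[|S]).tilted (S.indicator W))) * (∫ t, g (cfg t) ∂((γ[|S]).tilted (S.indicator W)))) -
            ((∫ t, Q₁ t * Q₂ t ∂γ) - (∫ t, Q₁ t ∂γ) * (∫ t, Q₂ t ∂γ))| := abs_sub_le _ _ _
    _ ≤ 6 * M * M * pY + (3 * M ^ 2 * (Real.exp (2 * w) - 1) + 6 * M ^ 2 * p + 2 * τ * (M + K) +
        Real.sqrt p * (2 * M * K + K' + K ^ 2)) := add_le_add h1 h3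

/-- **A-cov core, two constants (USE THIS ONE).**  As `abs_kernelCov_sub_gaussian_le_core` but with the GLOBAL bound `|βc| ≤ M₀` (YM side;
`M₀ = 4β` in the application, multiplied by the exponentially small `pY`) separated from the bound `βc ≤ M` ON THE GOOD EVENT `S` (`M = β^{2ε}` in the
application, multiplied by the tilt `e^{2w} − 1`).  With a single constant the instantiation would be forced to `M = 4β` and the tilt term
`3M²(e^{2w} − 1)` would not be small; the same remark applies to the mean core `abs_kernelMean_sub_gaussian_le_core` (use it with the observable
bound split likewise, or instantiate this pattern). -/
theorem abs_kernelCov_sub_gaussian_le_core₂ {H : ℕ} {β : ℝ} (ω : LGConfig 4 (Matrix.specialUnitaryGroup (Fin 2) ℂ))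
    (x y : Site 4) (i j k l : Fin 4)
    -- YM side: the good event of configurations
    {G : Set (LGConfig 4 (Matrix.specialUnitaryGroup (Fin 2) ℂ))} (hG : MeasurableSet G) (hG0 : boxKernel β H ω G ≠ 0)
    {pY : ℝ} (hpY : (boxKernel β H ω).real Gᶜ ≤ pY)
    {M₀ M : ℝ} (hM : 0 ≤ M) (hfM : ∀ U, |β * plaqCostAt (fundamentalRep (Fin 2)) x i j U| ≤ M₀)
    (hgM : ∀ U, |β * plaqCostAt (fundamentalRep (Fin 2)) y k l U| ≤ M₀)
    -- Gaussian side: chart map, small-field event, tilt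
    (cfg : (Fin 3 → EuclideanSpace ℝ (DirFree H)) → LGConfig 4 (Matrix.specialUnitaryGroup (Fin 2) ℂ)) (hcfg : Measurable cfg)
    {S : Set (Fin 3 → EuclideanSpace ℝ (DirFree H))} (hS : MeasurableSet S) (hS0 : (Measure.pi fun _ : Fin 3 => boxDirichlet H) S ≠ 0)
    {p : ℝ} (hp : (Measure.pi fun _ : Fin 3 => boxDirichlet H).real Sᶜ ≤ p)
    {W : (Fin 3 → EuclideanSpace ℝ (DirFree H)) → ℝ} (hWm : Measurable W) {w : ℝ} (hW : ∀ t, |S.indicator W t| ≤ w)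
    -- the representation (trunk) for the three observables
    (hRepF : ∫ U, β * plaqCostAt (fundamentalRep (Fin 2)) x i j U ∂((boxKernel β H ω)[|G]) =
      ∫ t, β * plaqCostAt (fundamentalRep (Fin 2)) x i j (cfg t)
        ∂(((Measure.pi fun _ : Fin 3 => boxDirichlet H)[|S]).tilted (S.indicator W)))
    (hRepG : ∫ U, β * plaqCostAt (fundamentalRep (Fin 2)) y k l U ∂((boxKernel β H ω)[|G]) =
      ∫ t, β * plaqCostAt (fundamentalRep (Fin 2)) y k l (cfg t)
        ∂(((Measure.pi fun _ : Fin 3 => boxDirichlet H)[|S]).tilted (S.indicator W)))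
    (hRepFG : ∫ U, β * plaqCostAt (fundamentalRep (Fin 2)) x i j U * (β * plaqCostAt (fundamentalRep (Fin 2)) y k l U)
        ∂((boxKernel β H ω)[|G]) =
      ∫ t, β * plaqCostAt (fundamentalRep (Fin 2)) x i j (cfg t) * (β * plaqCostAt (fundamentalRep (Fin 2)) y k l (cfg t))
        ∂(((Measure.pi fun _ : Fin 3 => boxDirichlet H)[|S]).tilted (S.indicator W)))
    -- the surrogates (chart) on `S` and their moments
    (F G' : Fin 3 → ℝ) (p' q' : Plaq 4) {τ K K' : ℝ} (hτ : 0 ≤ τ) (hK : 0 ≤ K) (hK' : 0 ≤ K')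
    (hFS : ∀ t ∈ S, 0 ≤ β * plaqCostAt (fundamentalRep (Fin 2)) x i j (cfg t) ∧ β * plaqCostAt (fundamentalRep (Fin 2)) x i j (cfg t) ≤ M)
    (hGS : ∀ t ∈ S, 0 ≤ β * plaqCostAt (fundamentalRep (Fin 2)) y k l (cfg t) ∧ β * plaqCostAt (fundamentalRep (Fin 2)) y k l (cfg t) ≤ M)
    (hSurF : ∀ t ∈ S, |β * plaqCostAt (fundamentalRep (Fin 2)) x i j (cfg t) - (1 / 2 : ℝ) * ∑ c, (F c + dirCirc H p' (t c)) ^ 2| ≤ τ)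
    (hSurG : ∀ t ∈ S, |β * plaqCostAt (fundamentalRep (Fin 2)) y k l (cfg t) - (1 / 2 : ℝ) * ∑ c, (G' c + dirCirc H q' (t c)) ^ 2| ≤ τ)
    (hQ₁₂ : MemLp (fun t : Fin 3 → EuclideanSpace ℝ (DirFree H) =>
      ((1 / 2 : ℝ) * ∑ c, (F c + dirCirc H p' (t c)) ^ 2) * ((1 / 2 : ℝ) * ∑ c, (G' c + dirCirc H q' (t c)) ^ 2)) 2
      (Measure.pi fun _ : Fin 3 => boxDirichlet H))
    (hK₁ : ∫ t, ((1 / 2 : ℝ) * ∑ c, (F c + dirCirc H p' (t c)) ^ 2) ^ 2 ∂(Measure.pi fun _ : Fin 3 => boxDirichlet H) ≤ K ^ 2)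
    (hK₂ : ∫ t, ((1 / 2 : ℝ) * ∑ c, (G' c + dirCirc H q' (t c)) ^ 2) ^ 2 ∂(Measure.pi fun _ : Fin 3 => boxDirichlet H) ≤ K ^ 2)
    (hK₁₂ : ∫ t, (((1 / 2 : ℝ) * ∑ c, (F c + dirCirc H p' (t c)) ^ 2) * ((1 / 2 : ℝ) * ∑ c, (G' c + dirCirc H q' (t c)) ^ 2)) ^ 2
      ∂(Measure.pi fun _ : Fin 3 => boxDirichlet H) ≤ K' ^ 2) :
    |β ^ 2 * ((∫ U, plaqCostAt (fundamentalRep (Fin 2)) x i j U * plaqCostAt (fundamentalRep (Fin 2)) y k l U ∂(boxKernel β H ω)) -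
          (∫ U, plaqCostAt (fundamentalRep (Fin 2)) x i j U ∂(boxKernel β H ω)) *
            (∫ U, plaqCostAt (fundamentalRep (Fin 2)) y k l U ∂(boxKernel β H ω))) -
        (3 / 2 * boxDirProjKernel H p' q' ^ 2 + (∑ c, F c * G' c) * boxDirProjKernel H p' q')| ≤
      6 * M₀ * M₀ * pY + (3 * M ^ 2 * (Real.exp (2 * w) - 1) + 6 * M ^ 2 * p + 2 * τ * (M + K) +
        Real.sqrt p * (2 * M * K + K' + K ^ 2)) := by
  haveI : IsProbabilityMeasure (boxKernel β H ω) := isProbabilityMeasure_boxKernel β H ω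
  set μ := boxKernel β H ω with hμ
  set γ : Measure (Fin 3 → EuclideanSpace ℝ (DirFree H)) := Measure.pi fun _ : Fin 3 => boxDirichlet H with hγ
  set f : LGConfig 4 (Matrix.specialUnitaryGroup (Fin 2) ℂ) → ℝ := fun U => β * plaqCostAt (fundamentalRep (Fin 2)) x i j U with hf
  set g : LGConfig 4 (Matrix.specialUnitaryGroup (Fin 2) ℂ) → ℝ := fun U => β * plaqCostAt (fundamentalRep (Fin 2)) y k l U with hg
  set Q₁ : (Fin 3 → EuclideanSpace ℝ (DirFree H)) → ℝ := fun t => (1 / 2 : ℝ) * ∑ c, (F c + dirCirc H p' (t c)) ^ 2 with hQ₁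
  set Q₂ : (Fin 3 → EuclideanSpace ℝ (DirFree H)) → ℝ := fun t => (1 / 2 : ℝ) * ∑ c, (G' c + dirCirc H q' (t c)) ^ 2 with hQ₂
  have hfm : Measurable f := measurable_const.mul (measurable_plaqCostAt x i j)
  have hgm : Measurable g := measurable_const.mul (measurable_plaqCostAt y k l)
  have hfi : Integrable f μ := integrable_of_abs_le hfm.aestronglyMeasurable hfM
  have hgi : Integrable g μ := integrable_of_abs_le hgm.aestronglyMeasurable hgM
  have hfgi : Integrable (fun U => f U * g U) μ :=
    hgi.bdd_mul hfm.aestronglyMeasurable (ae_of_all _ fun U => by rw [Real.norm_eq_abs]; exact hfM U)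
  -- (0) `β²·Cov(c_x, c_y) = Cov(βc_x, βc_y)`
  have e0 : β ^ 2 * ((∫ U, plaqCostAt (fundamentalRep (Fin 2)) x i j U * plaqCostAt (fundamentalRep (Fin 2)) y k l U ∂μ) -
        (∫ U, plaqCostAt (fundamentalRep (Fin 2)) x i j U ∂μ) * (∫ U, plaqCostAt (fundamentalRep (Fin 2)) y k l U ∂μ)) =
      (∫ U, f U * g U ∂μ) - (∫ U, f U ∂μ) * (∫ U, g U ∂μ) := by
    have e1 : ∫ U, f U * g U ∂μ = β ^ 2 * ∫ U, plaqCostAt (fundamentalRep (Fin 2)) x i j U * plaqCostAt (fundamentalRep (Fin 2)) y k l U ∂μ := by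
      rw [← integral_const_mul]; refine integral_congr_ae (ae_of_all _ fun U => ?_); simp only [hf, hg]; ring
    rw [e1, hf, hg, integral_const_mul, integral_const_mul]; ring
  -- (1) YM conditioning
  have h1 : |((∫ U, f U * g U ∂μ) - (∫ U, f U ∂μ) * (∫ U, g U ∂μ)) -
      ((∫ U, f U * g U ∂(μ[|G])) - (∫ U, f U ∂(μ[|G])) * (∫ U, g U ∂(μ[|G])))| ≤ 6 * M₀ * M₀ * pY := by
    have key := abs_cov_sub_cov_cond_le (μ := μ) hG hG0 hfi hgi hfgi hfM hgM
    have h6 : 0 ≤ 6 * M₀ * M₀ := by nlinarith [sq_nonneg M₀]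
    exact key.trans (mul_le_mul_of_nonneg_left hpY h6)
  -- (2)+(3) representation and covariance bookkeeping on the Gaussian side
  have hQ₁m : MemLp Q₁ 2 γ := memLp_two_quadObs_pi F p'
  have hQ₂m : MemLp Q₂ 2 γ := memLp_two_quadObs_pi G' q'
  have hFm : Measurable fun t => f (cfg t) := hfm.comp hcfg
  have hGm : Measurable fun t => g (cfg t) := hgm.comp hcfg
  have h3 := abs_cov_tilted_cond_sub_cov_le (γ := γ) hS hS0 hWm hW (F := fun t => f (cfg t)) (G := fun t => g (cfg t))
    (Q₁ := Q₁) (Q₂ := Q₂) hFm hGm hQ₁m hQ₂m hQ₁₂ hM hτ hK hK' hFS hGS hSurF hSurG hp hK₁ hK₂ hK₁₂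
  -- (4) the exact Gaussian covariance
  have h4 : (∫ t, Q₁ t * Q₂ t ∂γ) - (∫ t, Q₁ t ∂γ) * (∫ t, Q₂ t ∂γ) =
      3 / 2 * boxDirProjKernel H p' q' ^ 2 + (∑ c, F c * G' c) * boxDirProjKernel H p' q' := cov_quadObs_pi_eq F G' p' q'
  -- assemble
  rw [e0, ← h4]
  have hrepF' : ∫ U, f U ∂(μ[|G]) = ∫ t, f (cfg t) ∂((γ[|S]).tilted (S.indicator W)) := hRepF
  have hrepG' : ∫ U, g U ∂(μ[|G]) = ∫ t, g (cfg t) ∂((γ[|S]).tilted (S.indicator W)) := hRepG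
  have hrepFG' : ∫ U, f U * g U ∂(μ[|G]) = ∫ t, f (cfg t) * g (cfg t) ∂((γ[|S]).tilted (S.indicator W)) := hRepFG
  rw [hrepF', hrepG', hrepFG'] at h1
  calc |((∫ U, f U * g U ∂μ) - (∫ U, f U ∂μ) * (∫ U, g U ∂μ)) - ((∫ t, Q₁ t * Q₂ t ∂γ) - (∫ t, Q₁ t ∂γ) * (∫ t, Q₂ t ∂γ))|
      ≤ |((∫ U, f U * g U ∂μ) - (∫ U, f U ∂μ) * (∫ U, g U ∂μ)) -
            ((∫ t, f (cfg t) * g (cfg t) ∂((γ[|S]).tilted (S.indicator W))) -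
              (∫ t, f (cfg t) ∂((γ[|S]).tilted (S.indicator W))) * (∫ t, g (cfg t) ∂((γ[|S]).tilted (S.indicator W))))| +
          |((∫ t, f (cfg t) * g (cfg t) ∂((γ[|S]).tilted (S.indicator W))) -
              (∫ t, f (cfg t) ∂((γ[|S]).tilted (S.indicator W))) * (∫ t, g (cfg t) ∂((γ[|S]).tilted (S.indicator W)))) -
            ((∫ t, Q₁ t * Q₂ t ∂γ) - (∫ t, Q₁ t ∂γ) * (∫ t, Q₂ t ∂γ))| := abs_sub_le _ _ _
    _ ≤ 6 * M₀ * M₀ * pY + (3 * M ^ 2 * (Real.exp (2 * w) - 1) + 6 * M ^ 2 * p + 2 * τ * (M + K) +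
        Real.sqrt p * (2 * M * K + K' + K ^ 2)) := add_le_add h1 h3

end Summit.QuantumFields.YangMills.Theorems.WeakCouplingRates

end
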